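import Summits.ValiantsHypothesis.ValiantsHypothesis.Theorems.KPlusLogSqLawTropicalBMarkedEdgeCoreQLawModPC
import Summits.ValiantsHypothesis.ValiantsHypothesis.Theorems.KPlusLogSqLawTropicalBMarkedEdgeFactorThree
import Summits.ValiantsHypothesis.ValiantsHypothesis.Theorems.KPlusLogSqLawTropicalBMarkedEdgeCoreHeight

/-!
# Route «KPlusLogSqLaw», crux `TropicalB` (stmt-ValiantsHypothesis-19771) — MARKED-EDGE sector, NESTED-TRIANGLE CORE, ALL sizes:
# `law_of_cover_BC` — ONE compatible cover with a non-trivial marked pattern next to the Q-cover kills the realisation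

HONEST FRAMING.  Helper file (cell `pub-symmetroid`, seat val-sym-trop-p4 (g19), 2026-08-29; `--supports stmt-ValiantsHypothesis-19771 --as
helper`).  Sharpens `law_of_pcD_BC` (p681550) to the form in which the P-completion is LOCATED (memo S3STAR-PROOF-g19 §6): it is enough to have,
next to the Q₁₈-cover `T`, ONE cover `N` such that `[T i, N i]` fits into the arc multiset `[σB i, σC i, σC i, σZ i]` at every node (the two
left-over targets `p i, q i` being arbitrary) and whose set of marked fixed points is not one of the three «trivial» sets {b0,b1,b2}, {b3},
{b1,b3}.  The two left-over maps are completed to covers by Hall (`split_two`, p671215), the loop bookkeeping at the marked rows shows that the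
resulting doubled-colour factorisation is Karamata-dominant unless all three patterns are trivial, and `law_of_pcD_BC` concludes.  The EXISTENCE of
such an `N` in every realisation is located (0 exceptions, > 250 000 kernel-valid systems) and OPEN.  Nothing here proves the law; nothing
concerns `TropicalB` in its window, `WeakLifting`, the doors, `MatrixDescartes` (stmt-ValiantsHypothesis-18050) or VP ≠ VNP.
-/

set_option linter.dupNamespace false
set_option autoImplicit false

namespace Summit.ValiantsHypothesis.ValiantsHypothesis.Theorems.KPlusLogSqLaw
namespace MarkedEdge
namespace Core

open Finset

variable {V : Type*} [Fintype V] [DecidableEq V]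

omit [Fintype V] in
/-- Loop bookkeeping: if `v` occurs exactly twice in `l ~ [t, x, y, z]` and `t ≠ v`, exactly two of `x, y, z` equal `v`. [folklore] -/
theorem two_of_four {t x y z v : V} {l : List V} (h : List.Perm [t, x, y, z] l) (hc : l.count v = 2) (ht : t ≠ v) :
    (x = v ∧ y = v ∧ z ≠ v) ∨ (x = v ∧ y ≠ v ∧ z = v) ∨ (x ≠ v ∧ y = v ∧ z = v) := by
  have hc' := h.count_eq v
  rw [hc] at hc'
  by_cases hx : x = v <;> by_cases hy : y = v <;> by_cases hz : z = v <;> simp [hx, hy, hz, ht] at hc' ⊢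

omit [Fintype V] in
/-- Loop bookkeeping: if `v` occurs exactly once in `l ~ [t, x, y, z]` and `t ≠ v`, exactly one of `x, y, z` equals `v`. [folklore] -/
theorem one_of_four {t x y z v : V} {l : List V} (h : List.Perm [t, x, y, z] l) (hc : l.count v = 1) (ht : t ≠ v) :
    (x = v ∧ y ≠ v ∧ z ≠ v) ∨ (x ≠ v ∧ y = v ∧ z ≠ v) ∨ (x ≠ v ∧ y ≠ v ∧ z = v) := by
  have hc' := h.count_eq v
  rw [hc] at hc'
  by_cases hx : x = v <;> by_cases hy : y = v <;> by_cases hz : z = v <;> simp [hx, hy, hz, ht] at hc' ⊢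

omit [Fintype V] in
/-- Loop bookkeeping: if `v` occurs exactly once in `l ~ [t, x, y, z]` and `t = v`, none of `x, y, z` equals `v`. [folklore] -/
theorem none_of_four {t x y z v : V} {l : List V} (h : List.Perm [t, x, y, z] l) (hc : l.count v = 1) (ht : t = v) :
    x ≠ v ∧ y ≠ v ∧ z ≠ v := by
  have hc' := h.count_eq v
  rw [hc] at hc'
  subst ht
  by_cases hx : x = t <;> by_cases hy : y = t <;> by_cases hz : z = t <;> simp [hx, hy, hz] at hc' ⊢

omit [Fintype V] in
/-- Loop bookkeeping: if `v` occurs exactly three times in `l ~ [t, x, y, z]` and `t = v`, exactly two of `x, y, z` equal `v`. [folklore] -/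
theorem two_of_four' {t x y z v : V} {l : List V} (h : List.Perm [t, x, y, z] l) (hc : l.count v = 3) (ht : t = v) :
    (x = v ∧ y = v ∧ z ≠ v) ∨ (x = v ∧ y ≠ v ∧ z = v) ∨ (x ≠ v ∧ y = v ∧ z = v) := by
  have hc' := h.count_eq v
  rw [hc] at hc'
  subst ht
  by_cases hx : x = t <;> by_cases hy : y = t <;> by_cases hz : z = t <;> simp [hx, hy, hz] at hc' ⊢

omit [Fintype V] [DecidableEq V] in
/-- reorder: swap the first two of four. [folklore] -/
theorem sw12 {a c d e : V} {l : List V} (h : List.Perm [a, c, d, e] l) : List.Perm [c, a, d, e] l :=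
  (List.Perm.swap a c [d, e]).trans h

omit [Fintype V] [DecidableEq V] in
/-- reorder: move the last of four to the front. [folklore] -/
theorem rot4 {a c d e : V} {l : List V} (h : List.Perm [a, c, d, e] l) : List.Perm [e, a, c, d] l := by
  have : List.Perm [e, a, c, d] [a, c, d, e] := List.perm_append_comm (l₁ := [e]) (l₂ := [a, c, d])
  exact this.trans h

/-- **Completion of two compatible covers** (Hall, `split_two`): if `[T i, N i, p i, q i]` is a rearrangement of `[σ₁ i, σ₂ i, σ₃ i, σ₄ i]` at
every node, for covers `T, N` and arbitrary maps `p, q`, then there are covers `N₂, N₃` with `[N i, N₂ i, N₃ i, T i] ~ [σ₁ i, σ₂ i, σ₃ i, σ₄ i]`.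
[folklore] -/
theorem complete_two (σ₁ σ₂ σ₃ σ₄ T N : Equiv.Perm V) (p q : V → V)
    (hrow : ∀ i, List.Perm [T i, N i, p i, q i] [σ₁ i, σ₂ i, σ₃ i, σ₄ i]) :
    ∃ N₂ N₃ : Equiv.Perm V, ∀ i, List.Perm [N i, N₂ i, N₃ i, T i] [σ₁ i, σ₂ i, σ₃ i, σ₄ i] := by
  classical
  have hcol : ∀ j, (∑ i, if p i = j then (1 : ℕ) else 0) + (∑ i, if q i = j then (1 : ℕ) else 0) = 2 := by
    intro j
    have hpt : ∀ i, (if T i = j then (1 : ℕ) else 0) + (if N i = j then 1 else 0) + (if p i = j then 1 else 0) +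
        (if q i = j then 1 else 0)
        = (if σ₁ i = j then (1 : ℕ) else 0) + (if σ₂ i = j then 1 else 0) + (if σ₃ i = j then 1 else 0) +
          (if σ₄ i = j then 1 else 0) := by
      intro i
      have := ((hrow i).map fun x => if x = j then (1 : ℕ) else 0).sum_eq
      simpa [add_assoc] using this
    have hsum := Finset.sum_congr rfl fun i (_ : i ∈ (Finset.univ : Finset V)) => hpt i
    rw [Finset.sum_add_distrib, Finset.sum_add_distrib, Finset.sum_add_distrib, Finset.sum_add_distrib,
      Finset.sum_add_distrib, Finset.sum_add_distrib, FourBit.sum_ite_apply_eq T j, FourBit.sum_ite_apply_eq N j,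
      FourBit.sum_ite_apply_eq σ₁ j, FourBit.sum_ite_apply_eq σ₂ j, FourBit.sum_ite_apply_eq σ₃ j,
      FourBit.sum_ite_apply_eq σ₄ j] at hsum
    omega
  obtain ⟨f, g, hf, hg, hfg⟩ := split_two p q hcol
  refine ⟨Equiv.ofBijective f hf, Equiv.ofBijective g hg, fun i => ?_⟩
  have e1 : (Equiv.ofBijective f hf) i = f i := rfl
  have e2 : (Equiv.ofBijective g hg) i = g i := rfl
  rw [e1, e2]
  have hperm : List.Perm [N i, f i, g i, T i] [T i, N i, p i, q i] := by
    rcases hfg i with ⟨h1, h2⟩ | ⟨h1, h2⟩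
    · rw [h1, h2]
      exact List.perm_append_comm (l₁ := [N i, p i, q i]) (l₂ := [T i])
    · rw [h1, h2]
      have : List.Perm [N i, q i, p i, T i] [T i, N i, p i, q i] := by
        have h3 : List.Perm [N i, q i, p i, T i] [T i, N i, q i, p i] :=
          (List.perm_append_comm (l₁ := [N i, q i, p i]) (l₂ := [T i]))
        exact h3.trans (List.Perm.cons _ (List.Perm.cons _ (List.Perm.swap _ _ _)))
      exact this
  exact hperm.trans (hrow i)

section Core

variable (ok : V → V → Prop) (w g : V → V → ℤ) (b : Fin 5 → V)

/-- **`law_of_cover_BC`.**  In a realisation, let `T` be a Q₁₈-cover (inside `σB⊎σC⊎σZ`, marked fixed points exactly {b1,b4}) and `N` a cover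
such that `[T i, N i, p i, q i]` rearranges `[σB i, σC i, σC i, σZ i]` at every node for some maps `p, q`.  Then the marked fixed-point set of
`N` is one of the three TRIVIAL sets {b0,b1,b2}, {b3}, {b1,b3} — equivalently: a compatible cover with any other pattern is a Karamata
certificate (via `complete_two` and `law_of_pcD_BC`). [this seat's theorem] -/
theorem law_of_cover_BC (hb : Function.Injective b)
    (hoff : ∀ i j, j ≠ i → g i j = 0) (hmark : ∀ l, g (b l) (b l) = (2 : ℤ) ^ (l : ℕ)) (haux : ∀ i, (∀ l, b l ≠ i) → g i i = 0)
    {θB θC θZ : ℤ} {σB σC σZ : Equiv.Perm V} (hBC : θB < θC) (hCZ : θC < θZ)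
    (hB : (∀ i, ok i (σB i)) ∧ ∀ τ : Equiv.Perm V, τ ≠ σB → (∀ i, ok i (τ i)) →
      ∑ i, (w i (τ i) + θB * g i (τ i)) < ∑ i, (w i (σB i) + θB * g i (σB i)))
    (hC : (∀ i, ok i (σC i)) ∧ ∀ τ : Equiv.Perm V, τ ≠ σC → (∀ i, ok i (τ i)) →
      ∑ i, (w i (τ i) + θC * g i (τ i)) < ∑ i, (w i (σC i) + θC * g i (σC i)))
    (hZ : (∀ i, ok i (σZ i)) ∧ ∀ τ : Equiv.Perm V, τ ≠ σZ → (∀ i, ok i (τ i)) →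
      ∑ i, (w i (τ i) + θZ * g i (τ i)) < ∑ i, (w i (σZ i) + θZ * g i (σZ i)))
    (hB0 : σB (b 0) ≠ b 0) (hB1 : σB (b 1) = b 1) (hB2 : σB (b 2) = b 2) (hB3 : σB (b 3) ≠ b 3) (hB4 : σB (b 4) ≠ b 4)
    (hC0 : σC (b 0) ≠ b 0) (hC1 : σC (b 1) = b 1) (hC2 : σC (b 2) ≠ b 2) (hC3 : σC (b 3) = b 3) (hC4 : σC (b 4) ≠ b 4)
    (hZ0 : σZ (b 0) = b 0) (hZ1 : σZ (b 1) ≠ b 1) (hZ2 : σZ (b 2) ≠ b 2) (hZ3 : σZ (b 3) ≠ b 3) (hZ4 : σZ (b 4) = b 4)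
    {T N : Equiv.Perm V} {p q : V → V} (hrow : ∀ i, List.Perm [T i, N i, p i, q i] [σB i, σC i, σC i, σZ i])
    (hT0 : T (b 0) ≠ b 0) (hT1 : T (b 1) = b 1) (hT2 : T (b 2) ≠ b 2) (hT3 : T (b 3) ≠ b 3) (hT4 : T (b 4) = b 4) :
    (N (b 0) = b 0 ∧ N (b 1) = b 1 ∧ N (b 2) = b 2 ∧ N (b 3) ≠ b 3) ∨
    (N (b 0) ≠ b 0 ∧ N (b 1) ≠ b 1 ∧ N (b 2) ≠ b 2 ∧ N (b 3) = b 3) ∨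
    (N (b 0) ≠ b 0 ∧ N (b 1) = b 1 ∧ N (b 2) ≠ b 2 ∧ N (b 3) = b 3) := by
  obtain ⟨M, R, hP⟩ := complete_two σB σC σC σZ T N p q hrow
  have hQ : ∀ i, List.Perm [T i, N i, M i, R i] [σB i, σC i, σC i, σZ i] := fun i => rot4 (hP i)
  -- loop bookkeeping at the five marked rows
  obtain ⟨n4, m4, r4⟩ := none_of_four (v := b 4) (hQ (b 4)) (by simp [hB4, hC4, hZ4]) hT4
  have f3 := two_of_four (v := b 3) (hQ (b 3)) (by simp [hB3, hC3, hZ3]) hT3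
  have f1 := two_of_four' (v := b 1) (hQ (b 1)) (by simp [hB1, hC1, hZ1]) hT1
  have f2 := one_of_four (v := b 2) (hQ (b 2)) (by simp [hB2, hC2, hZ2]) hT2
  have f0 := one_of_four (v := b 0) (hQ (b 0)) (by simp [hB0, hC0, hZ0]) hT0
  -- slopes as functions of the marked fixed points
  have slope : ∀ X : Equiv.Perm V, (∑ i, g i (X i)) = (if X (b 0) = b 0 then 1 else 0) + (if X (b 1) = b 1 then 2 else 0) +
      (if X (b 2) = b 2 then 4 else 0) + (if X (b 3) = b 3 then 8 else 0) + (if X (b 4) = b 4 then 16 else 0) := by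
    intro X
    rw [slope_eq_sum_marked g b hb hoff hmark haux X, Fin.sum_univ_five]
    norm_num
  have sN := slope N
  have sM := slope M
  have sR := slope R
  -- the Karamata step in all six role assignments
  have K := fun (F₁ F₂ F₃ : Equiv.Perm V) (hF : ∀ i, List.Perm [F₁ i, F₂ i, F₃ i, T i] [σB i, σC i, σC i, σZ i])
      (h3 : 9 ≤ ∑ i, g i (F₃ i)) (h23 : 19 ≤ (∑ i, g i (F₂ i)) + ∑ i, g i (F₃ i)) =>
    law_of_pcD_BC ok w g b hb hoff hmark haux hBC hCZ hB hC hZ hB0 hB1 hB2 hB3 hB4 hC0 hC1 hC2 hC3 hC4 hZ0 hZ1 hZ2 hZ3 hZ4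
      hF hT0 hT1 hT4 h3 h23
  have P123 : ∀ i, List.Perm [N i, M i, R i, T i] [σB i, σC i, σC i, σZ i] := hP
  have P213 : ∀ i, List.Perm [M i, N i, R i, T i] [σB i, σC i, σC i, σZ i] := fun i => sw12 (hP i)
  have P132 : ∀ i, List.Perm [N i, R i, M i, T i] [σB i, σC i, σC i, σZ i] := fun i => perm4_swap12 (hP i)
  have P231 : ∀ i, List.Perm [M i, R i, N i, T i] [σB i, σC i, σC i, σZ i] := fun i => perm4_swap12 (sw12 (hP i))
  have P312 : ∀ i, List.Perm [R i, N i, M i, T i] [σB i, σC i, σC i, σZ i] := fun i => sw12 (perm4_swap12 (hP i))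
  have P321 : ∀ i, List.Perm [R i, M i, N i, T i] [σB i, σC i, σC i, σZ i] := fun i => sw12 (perm4_swap12 (sw12 (hP i)))
  rcases f3 with ⟨n3, m3, r3⟩ | ⟨n3, m3, r3⟩ | ⟨n3, m3, r3⟩ <;>
  rcases f1 with ⟨n1, m1, r1⟩ | ⟨n1, m1, r1⟩ | ⟨n1, m1, r1⟩ <;>
  rcases f2 with ⟨n2, m2, r2⟩ | ⟨n2, m2, r2⟩ | ⟨n2, m2, r2⟩ <;>
  rcases f0 with ⟨n0, m0, r0⟩ | ⟨n0, m0, r0⟩ | ⟨n0, m0, r0⟩ <;>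
  simp only [n0, n1, n2, n3, n4, m0, m1, m2, m3, m4, r0, r1, r2, r3, r4, if_true, if_false] at sN sM sR <;>
  norm_num at sN sM sR <;>
  first
    | exact Or.inl ⟨n0, n1, n2, n3⟩
    | exact Or.inr (Or.inl ⟨n0, n1, n2, n3⟩)
    | exact Or.inr (Or.inr ⟨n0, n1, n2, n3⟩)
    | exact (K N M R P123 (by omega) (by omega)).elim
    | exact (K N R M P132 (by omega) (by omega)).elim
    | exact (K M N R P213 (by omega) (by omega)).elim
    | exact (K M R N P231 (by omega) (by omega)).elim
    | exact (K R N M P312 (by omega) (by omega)).elim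
    | exact (K R M N P321 (by omega) (by omega)).elim

/-- **`law_of_cover_BE`.**  The same for the pair (B,E): next to a Q₂₀-cover `T` (inside `σB⊎σE⊎σZ`, marked fixed points exactly {b2,b4}), a
cover `N` with `[T i, N i, p i, q i] ~ [σB i, σE i, σE i, σZ i]` at every node has one of the three TRIVIAL patterns {b0,b1,b2}, {b3}, {b2,b3}.
[this seat's theorem] -/
theorem law_of_cover_BE (hb : Function.Injective b)
    (hoff : ∀ i j, j ≠ i → g i j = 0) (hmark : ∀ l, g (b l) (b l) = (2 : ℤ) ^ (l : ℕ)) (haux : ∀ i, (∀ l, b l ≠ i) → g i i = 0)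
    {θB θE θZ : ℤ} {σB σE σZ : Equiv.Perm V} (hBE : θB < θE) (hEZ : θE < θZ)
    (hB : (∀ i, ok i (σB i)) ∧ ∀ τ : Equiv.Perm V, τ ≠ σB → (∀ i, ok i (τ i)) →
      ∑ i, (w i (τ i) + θB * g i (τ i)) < ∑ i, (w i (σB i) + θB * g i (σB i)))
    (hE : (∀ i, ok i (σE i)) ∧ ∀ τ : Equiv.Perm V, τ ≠ σE → (∀ i, ok i (τ i)) →
      ∑ i, (w i (τ i) + θE * g i (τ i)) < ∑ i, (w i (σE i) + θE * g i (σE i)))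
    (hZ : (∀ i, ok i (σZ i)) ∧ ∀ τ : Equiv.Perm V, τ ≠ σZ → (∀ i, ok i (τ i)) →
      ∑ i, (w i (τ i) + θZ * g i (τ i)) < ∑ i, (w i (σZ i) + θZ * g i (σZ i)))
    (hB0 : σB (b 0) ≠ b 0) (hB1 : σB (b 1) = b 1) (hB2 : σB (b 2) = b 2) (hB3 : σB (b 3) ≠ b 3) (hB4 : σB (b 4) ≠ b 4)
    (hE0 : σE (b 0) ≠ b 0) (hE1 : σE (b 1) ≠ b 1) (hE2 : σE (b 2) = b 2) (hE3 : σE (b 3) = b 3) (hE4 : σE (b 4) ≠ b 4)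
    (hZ0 : σZ (b 0) = b 0) (hZ1 : σZ (b 1) ≠ b 1) (hZ2 : σZ (b 2) ≠ b 2) (hZ3 : σZ (b 3) ≠ b 3) (hZ4 : σZ (b 4) = b 4)
    {T N : Equiv.Perm V} {p q : V → V} (hrow : ∀ i, List.Perm [T i, N i, p i, q i] [σB i, σE i, σE i, σZ i])
    (hT0 : T (b 0) ≠ b 0) (hT1 : T (b 1) ≠ b 1) (hT2 : T (b 2) = b 2) (hT3 : T (b 3) ≠ b 3) (hT4 : T (b 4) = b 4) :
    (N (b 0) = b 0 ∧ N (b 1) = b 1 ∧ N (b 2) = b 2 ∧ N (b 3) ≠ b 3) ∨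
    (N (b 0) ≠ b 0 ∧ N (b 1) ≠ b 1 ∧ N (b 2) ≠ b 2 ∧ N (b 3) = b 3) ∨
    (N (b 0) ≠ b 0 ∧ N (b 1) ≠ b 1 ∧ N (b 2) = b 2 ∧ N (b 3) = b 3) := by
  obtain ⟨M, R, hP⟩ := complete_two σB σE σE σZ T N p q hrow
  have hQ : ∀ i, List.Perm [T i, N i, M i, R i] [σB i, σE i, σE i, σZ i] := fun i => rot4 (hP i)
  obtain ⟨n4, m4, r4⟩ := none_of_four (v := b 4) (hQ (b 4)) (by simp [hB4, hE4, hZ4]) hT4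
  have f3 := two_of_four (v := b 3) (hQ (b 3)) (by simp [hB3, hE3, hZ3]) hT3
  have f2 := two_of_four' (v := b 2) (hQ (b 2)) (by simp [hB2, hE2, hZ2]) hT2
  have f1 := one_of_four (v := b 1) (hQ (b 1)) (by simp [hB1, hE1, hZ1]) hT1
  have f0 := one_of_four (v := b 0) (hQ (b 0)) (by simp [hB0, hE0, hZ0]) hT0
  have slope : ∀ X : Equiv.Perm V, (∑ i, g i (X i)) = (if X (b 0) = b 0 then 1 else 0) + (if X (b 1) = b 1 then 2 else 0) +
      (if X (b 2) = b 2 then 4 else 0) + (if X (b 3) = b 3 then 8 else 0) + (if X (b 4) = b 4 then 16 else 0) := by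
    intro X
    rw [slope_eq_sum_marked g b hb hoff hmark haux X, Fin.sum_univ_five]
    norm_num
  have sN := slope N
  have sM := slope M
  have sR := slope R
  have K := fun (F₁ F₂ F₃ : Equiv.Perm V) (hF : ∀ i, List.Perm [F₁ i, F₂ i, F₃ i, T i] [σB i, σE i, σE i, σZ i])
      (h3 : 9 ≤ ∑ i, g i (F₃ i)) (h23 : 21 ≤ (∑ i, g i (F₂ i)) + ∑ i, g i (F₃ i)) =>
    law_of_pcD_BE ok w g b hb hoff hmark haux hBE hEZ hB hE hZ hB0 hB1 hB2 hB3 hB4 hE0 hE1 hE2 hE3 hE4 hZ0 hZ1 hZ2 hZ3 hZ4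
      hF hT0 hT2 hT4 h3 h23
  have P123 : ∀ i, List.Perm [N i, M i, R i, T i] [σB i, σE i, σE i, σZ i] := hP
  have P213 : ∀ i, List.Perm [M i, N i, R i, T i] [σB i, σE i, σE i, σZ i] := fun i => sw12 (hP i)
  have P132 : ∀ i, List.Perm [N i, R i, M i, T i] [σB i, σE i, σE i, σZ i] := fun i => perm4_swap12 (hP i)
  have P231 : ∀ i, List.Perm [M i, R i, N i, T i] [σB i, σE i, σE i, σZ i] := fun i => perm4_swap12 (sw12 (hP i))
  have P312 : ∀ i, List.Perm [R i, N i, M i, T i] [σB i, σE i, σE i, σZ i] := fun i => sw12 (perm4_swap12 (hP i))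
  have P321 : ∀ i, List.Perm [R i, M i, N i, T i] [σB i, σE i, σE i, σZ i] := fun i => sw12 (perm4_swap12 (sw12 (hP i)))
  rcases f3 with ⟨n3, m3, r3⟩ | ⟨n3, m3, r3⟩ | ⟨n3, m3, r3⟩ <;>
  rcases f2 with ⟨n2, m2, r2⟩ | ⟨n2, m2, r2⟩ | ⟨n2, m2, r2⟩ <;>
  rcases f1 with ⟨n1, m1, r1⟩ | ⟨n1, m1, r1⟩ | ⟨n1, m1, r1⟩ <;>
  rcases f0 with ⟨n0, m0, r0⟩ | ⟨n0, m0, r0⟩ | ⟨n0, m0, r0⟩ <;>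
  simp only [n0, n1, n2, n3, n4, m0, m1, m2, m3, m4, r0, r1, r2, r3, r4, if_true, if_false] at sN sM sR <;>
  norm_num at sN sM sR <;>
  first
    | exact Or.inl ⟨n0, n1, n2, n3⟩
    | exact Or.inr (Or.inl ⟨n0, n1, n2, n3⟩)
    | exact Or.inr (Or.inr ⟨n0, n1, n2, n3⟩)
    | exact (K N M R P123 (by omega) (by omega)).elim
    | exact (K N R M P132 (by omega) (by omega)).elim
    | exact (K M N R P213 (by omega) (by omega)).elim
    | exact (K M R N P231 (by omega) (by omega)).elim
    | exact (K R N M P312 (by omega) (by omega)).elim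
    | exact (K R M N P321 (by omega) (by omega)).elim

/-- **The all-m nested-triangle law modulo the P-completion in cover form.**  If in the realisation every Q₁₈-cover of `σB⊎σC⊎σZ` admits a
compatible cover `N` (two left-over targets arbitrary) with a NON-trivial marked pattern, and likewise every Q₂₀-cover of `σB⊎σE⊎σZ`, then the
nested-triangle core is not realisable.  (The two hypotheses are the located P-completion PC-D, memo S3STAR-PROOF-g19 §6.) [this seat's theorem] -/
theorem nestedTriangle_false_of_covers (hb : Function.Injective b)
    (hoff : ∀ i j, j ≠ i → g i j = 0) (hmark : ∀ l, g (b l) (b l) = (2 : ℤ) ^ (l : ℕ)) (haux : ∀ i, (∀ l, b l ≠ i) → g i i = 0)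
    {θB θC θE θZ : ℤ} {σB σC σE σZ : Equiv.Perm V}
    (hB : (∀ i, ok i (σB i)) ∧ ∀ τ : Equiv.Perm V, τ ≠ σB → (∀ i, ok i (τ i)) →
      ∑ i, (w i (τ i) + θB * g i (τ i)) < ∑ i, (w i (σB i) + θB * g i (σB i)))
    (hC : (∀ i, ok i (σC i)) ∧ ∀ τ : Equiv.Perm V, τ ≠ σC → (∀ i, ok i (τ i)) →
      ∑ i, (w i (τ i) + θC * g i (τ i)) < ∑ i, (w i (σC i) + θC * g i (σC i)))
    (hE : (∀ i, ok i (σE i)) ∧ ∀ τ : Equiv.Perm V, τ ≠ σE → (∀ i, ok i (τ i)) →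
      ∑ i, (w i (τ i) + θE * g i (τ i)) < ∑ i, (w i (σE i) + θE * g i (σE i)))
    (hZ : (∀ i, ok i (σZ i)) ∧ ∀ τ : Equiv.Perm V, τ ≠ σZ → (∀ i, ok i (τ i)) →
      ∑ i, (w i (τ i) + θZ * g i (τ i)) < ∑ i, (w i (σZ i) + θZ * g i (σZ i)))
    (hB0 : σB (b 0) ≠ b 0) (hB1 : σB (b 1) = b 1) (hB2 : σB (b 2) = b 2) (hB3 : σB (b 3) ≠ b 3) (hB4 : σB (b 4) ≠ b 4)
    (hC0 : σC (b 0) ≠ b 0) (hC1 : σC (b 1) = b 1) (hC2 : σC (b 2) ≠ b 2) (hC3 : σC (b 3) = b 3) (hC4 : σC (b 4) ≠ b 4)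
    (hE0 : σE (b 0) ≠ b 0) (hE1 : σE (b 1) ≠ b 1) (hE2 : σE (b 2) = b 2) (hE3 : σE (b 3) = b 3) (hE4 : σE (b 4) ≠ b 4)
    (hZ0 : σZ (b 0) = b 0) (hZ1 : σZ (b 1) ≠ b 1) (hZ2 : σZ (b 2) ≠ b 2) (hZ3 : σZ (b 3) ≠ b 3) (hZ4 : σZ (b 4) = b 4)
    (hPC_BC : ∀ T : Equiv.Perm V, (∀ i, T i = σB i ∨ T i = σC i ∨ T i = σZ i) →
      T (b 0) ≠ b 0 → T (b 1) = b 1 → T (b 2) ≠ b 2 → T (b 3) ≠ b 3 → T (b 4) = b 4 →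
      ∃ (N : Equiv.Perm V) (p q : V → V), (∀ i, List.Perm [T i, N i, p i, q i] [σB i, σC i, σC i, σZ i]) ∧
        ¬ ((N (b 0) = b 0 ∧ N (b 1) = b 1 ∧ N (b 2) = b 2 ∧ N (b 3) ≠ b 3) ∨
           (N (b 0) ≠ b 0 ∧ N (b 1) ≠ b 1 ∧ N (b 2) ≠ b 2 ∧ N (b 3) = b 3) ∨
           (N (b 0) ≠ b 0 ∧ N (b 1) = b 1 ∧ N (b 2) ≠ b 2 ∧ N (b 3) = b 3)))
    (hPC_BE : ∀ T : Equiv.Perm V, (∀ i, T i = σB i ∨ T i = σE i ∨ T i = σZ i) →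
      T (b 0) ≠ b 0 → T (b 1) ≠ b 1 → T (b 2) = b 2 → T (b 3) ≠ b 3 → T (b 4) = b 4 →
      ∃ (N : Equiv.Perm V) (p q : V → V), (∀ i, List.Perm [T i, N i, p i, q i] [σB i, σE i, σE i, σZ i]) ∧
        ¬ ((N (b 0) = b 0 ∧ N (b 1) = b 1 ∧ N (b 2) = b 2 ∧ N (b 3) ≠ b 3) ∨
           (N (b 0) ≠ b 0 ∧ N (b 1) ≠ b 1 ∧ N (b 2) ≠ b 2 ∧ N (b 3) = b 3) ∨
           (N (b 0) ≠ b 0 ∧ N (b 1) ≠ b 1 ∧ N (b 2) = b 2 ∧ N (b 3) = b 3))) : False := by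
  obtain ⟨hBC, hCE, hEZ⟩ := theta_order ok w g b hb hoff hmark haux hB hC hE hZ hB0 hB1 hB2 hB3 hB4 hC0 hC1 hC2 hC3 hC4
    hE0 hE1 hE2 hE3 hE4 hZ0 hZ1 hZ2 hZ3 hZ4
  rcases core_S3 ok w g b hb hoff hmark haux hB hC hE hZ hB0 hB1 hB2 hB3 hB4 hC0 hC1 hC2 hC3 hC4 hE0 hE1 hE2 hE3 hE4 hZ0 hZ1 hZ2
      hZ3 hZ4 with ⟨T, hT, h0, h1, h2, h3, h4⟩ | ⟨T, hT, h0, h1, h2, h3, h4⟩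
  · obtain ⟨N, p, q, hrow, hN⟩ := hPC_BC T hT h0 h1 h2 h3 h4
    exact hN (law_of_cover_BC ok w g b hb hoff hmark haux hBC (hCE.trans hEZ) hB hC hZ hB0 hB1 hB2 hB3 hB4 hC0 hC1 hC2 hC3 hC4
      hZ0 hZ1 hZ2 hZ3 hZ4 hrow h0 h1 h2 h3 h4)
  · obtain ⟨N, p, q, hrow, hN⟩ := hPC_BE T hT h0 h1 h2 h3 h4
    exact hN (law_of_cover_BE ok w g b hb hoff hmark haux (hBC.trans hCE) hEZ hB hE hZ hB0 hB1 hB2 hB3 hB4 hE0 hE1 hE2 hE3 hE4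
      hZ0 hZ1 hZ2 hZ3 hZ4 hrow h0 h1 h2 h3 h4)

end Core

end Core
end MarkedEdge
end Summit.ValiantsHypothesis.ValiantsHypothesis.Theorems.KPlusLogSqLaw
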